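import Summits.QuantumFields.YangMills.Theorems.UnitScaleTiltProp7TJL2BoundOfSupRow
import Summits.QuantumFields.YangMills.Theorems.UnitScaleTiltProp7QkWeightConjugation
import Summits.QuantumFields.YangMills.Theorems.UnitScaleTiltProp7OneFormAgmonWeights
import Summits.QuantumFields.YangMills.Theorems.UnitScaleTiltProp7CoerciveOfNormG0
import HarnessLib

/-!
# Route `UnitScaleTilt`, crux K1 «MinimiserStabilityRegPr» (stmt-QuantumFields-19200), EX rows `h137kπ` ∕ `h137kΔ` ∕ `hCk` — K-STOREY, FILE (K2b-δ₃)-S: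
# **THE CONJUGATED-RESOLVENT ROW `δ₃` OF `G` AT ANY SLOT FROM THE SLOT'S GREEN BLOCK ROWS `hGblk` — COMBES–THOMAS FROM DECAY**
# (the `hres` letter of px10 ✓`Prop7KinvRowOfConjLetters.kinvRow_of_coercive_of_conjResolvent`, VERBATIM, from the `hGblk` letter of px10
# ✓`Prop7Kernel133DoorOfKinvRow.kernel133_of_kinvRow_of_greenBlockSup`, VERBATIM)

Cell `ym3-torus` (HUMAN RULING D-0037; rung R3 = SU(2) YM₃ on T³ — NOT d = 4, NOT infinite volume, NOT a mass gap, NOT Clay).  Width seat `ym3-torus-px12` (gen 17), CLAIM 2026-08-30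
11:58Z (first refusal px10 g14 ∕ ★p1 g27 ∕ px16 g14).  THEOREMS ONLY (0 `def`, 0 `sorry`, default heartbeats); `--supports stmt-QuantumFields-19200 --as helper`; count-neutral.

THE MATHEMATICS ([Balaban1985BackgroundPropagators] Thm 3.1 (3.46) p. 398 «|G(x,y)| ≤ O(1)e^{−δ₀|x−y|}» ⟹ the conjugated operators `e^{φ}Ge^{−φ}` stay close to `G` for phases `φ` of small
slope — the converse direction of the Combes–Thomas argument; print uses it silently in [Balaban1984PropagatorsII] §2 for `(QGQ*)⁻¹`, (3.132) p. 422).  `T := M_f∘G∘M_fi − G`,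
`M_f ↔ e^{φ(b₋)}`, `M_fi ↔ e^{−φ(b₋)}`, `|φx − φx′| ≤ μη·|x − x′|₁` (so `|φx − φx′| ≤ μ(tdist(Bx, Bx′) + d)`, ✓`Prop7OneFormAgmonWeights.abs_sub_le_coarse`).  For a source `X` supported
on the bonds of ONE block `z` with `‖X b‖ ≤ s`, and `x⋆ := b₀₋` for any bond `b₀` of the support, `M_fi(toL2 X) = e^{−φ(x⋆)}·toL2 W`, `W b := e^{φ(x⋆)−φ(b₋)}X b` (block-supported,
sup `≤ e^{μd}s`), hence `(toL2⁻¹(T(toL2 X)))(bd) = (e^{φ(bd₋)−φ(x⋆)} − 1)·(toL2⁻¹ G toL2 W)(bd) + (toL2⁻¹ G toL2 (W − X))(bd)` (`W − X` block-supported, sup `≤ (e^{μd} − 1)s`); the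
block rows of `G` (`hGblk`, constant `C_G`, rate `δ`) give the BLOCK ROW of `T`: `‖…(bd)‖ ≤ s·C_G·(e^{μ(t+2d)} − 1)·e^{−δt} ≤ s·[C_G·μ·(2∕(δ−μ) + 2d)·e^{2dμ}]·e^{−((δ−μ)∕2)t}`,
`t = tdist(B bd₋, z)`, `0 ≤ μ < δ`.  Summing the block decomposition `X = Σ_z X_z` (✓`sum_exp_neg_mul_tdist_coarse_le`) gives the FULL SUP ROW `k := C_G·μ·(2∕(δ−μ)+2d)·e^{2dμ}·
(2(1+2∕(δ−μ)))³` of `T`, and of `T′ := M_fi∘G∘M_f − G` (the class is symmetric under `φ ↦ −φ`).  Since `⟪Tx, y⟫ = ⟪x, T′y⟫` (✓`inner_weight_comm`, ✓`GT_isSymmetric`), `T + T′` and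
`I•(T − T′)` are SYMMETRIC with sup rows `2k`, so ★p1's spectral letter ✓`Prop7TJL2BoundOfSupRow.inner_le_of_isSymmetric_of_supRow` (coordinate reading `toL2⁻¹`) gives
`‖Tx‖ ≤ 2k‖x‖`: **`δ₃ := 2k = O(μ)·C_G`**, K-free iff `C_G` is.

WHAT IS PROVED (ns `Summit.QuantumFields.YangMills.Theorems.Prop7ConjResolventOfGreenBlockRows`).  §1 (abstract) `norm_le_of_form_bound`, ★`norm_le_of_supRow_pair` (`⟪Tx, y⟫ = ⟪x, T′y⟫`
+ sup rows `k`, `k′` of `T`, `T′` ⟹ `‖Tx‖ ≤ (k + k′)‖x‖`).  §2 (member) ★`supRow_of_blockRows` (block rows at rate `ν > 0`, constant `C` ⟹ full sup row `C·(2(1+1∕ν))³`).  §3 `two_d_le_exp_mul`,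
`exp_sub_one_decay_le`, ★★`blockRow_conj_sub_of_blockRows` (for ANY linear `G` with `hGblk`-shaped block rows and multipliers `M_o ↔ e^{ψ(b₋)}`, `M_i ↔ e^{−ψ(b₋)}`, `0 ≤ μ < δ`: the block
rows of `M_o∘G∘M_i − G` displayed above).  §4 ★★★`conj_resolvent_of_greenBlockSup` — member, ANY slot `Δx` with `PosOnto … a Δx U₀` and `(Δx U₀).IsSymmetric`, `hGblk` VERBATIM (px10's
H-DOOR binder), `0 ≤ C_G`, `0 ≤ μ < δ` ⟹ **px10's `hres` TEXT** (✓p768818 §2's binder, token for token) with `δ₃ := 2·(C_G·(μ·(2∕(δ−μ) + 6)·e^{6μ})·(2(1+2∕(δ−μ)))³)`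
(`2d = 6`, ✓`T3Family.P_d`).  §5 ★★`conj_resolvent_DeltaEtaSlot_of_greenBlockSup` ∕ ★★`conj_resolvent_DeltaPiSlotP_of_greenBlockSup` — the two slots of record, symmetry discharged
(✓`DeltaEtaSlot_isSymmetric`, ✓`DeltaPiP_isSymmetric`): `hres`(η) ⟸ N4's `hGblk`(η) (px16 ✓`Prop7OneFormGreenBlockColumn…`), `hres`(Π) ⟸ N6 D3's `hGblk`(Π) (★p1).
HYP-SAT (★★OWNER №42).  `hGblk` is a displayed row of record with named suppliers (N4 px16; N6 D2∕D3 ★p1), class (1); `PosOnto` + slot symmetry are inhabited on the literal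
slots (§5); the conclusion is an OPERATOR inequality, not restated by any hypothesis.  HONEST SCOPE.  Linear algebra and block bookkeeping over landed doors; no estimate of print is
proved; nothing of `hGblk`'s suppliers, `hKinv`, `h133`, `norm_G`, the 8 EX rows, `hThm2S`, EX or the crux is proved here; nothing continuum ∕ OS ∕ mass-gap ∕ Clay.

References: T. Bałaban, CMP **99** (1985) 389–434 [Balaban1985BackgroundPropagators] (Thm 3.1 (3.46) p.398, (3.49) p.399, (3.132) p.422, Thm 3.12 p.423); CMP **96** (1984)
223–250 [Balaban1984PropagatorsII] (§2); CMP **98** (1985) 17–51 [Balaban1985Averaging] ((2) p.17).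
-/

set_option autoImplicit false

noncomputable section

open scoped BigOperators Matrix.Norms.L2Operator InnerProductSpace ComplexConjugate
open Complex (I)

namespace Summit.QuantumFields.YangMills.Theorems.Prop7ConjResolventOfGreenBlockRows

/-! ## §1 Abstract: a norm bound from two sup rows and an adjoint pairing -/

section Abstract

variable {E : Type*} [NormedAddCommGroup E] [InnerProductSpace ℂ E]

/-- **FORM BOUND ⟹ NORM BOUND**: `‖⟪u, S w⟫‖ ≤ c‖u‖‖w‖` for all `u, w` (`0 ≤ c`) gives `‖S w‖ ≤ c‖w‖` (take `u := S w`). [folklore] -/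
theorem norm_le_of_form_bound (S : E →ₗ[ℂ] E) {c : ℝ} (hc : 0 ≤ c) (hS : ∀ u w : E, ‖⟪u, S w⟫_ℂ‖ ≤ c * ‖u‖ * ‖w‖) (w : E) :
    ‖S w‖ ≤ c * ‖w‖ := by
  by_cases h0 : S w = 0
  · rw [h0, norm_zero]; positivity
  · have hpos : 0 < ‖S w‖ := norm_pos_iff.2 h0
    have h1 : ‖⟪S w, S w⟫_ℂ‖ = ‖S w‖ * ‖S w‖ := by
      rw [inner_self_eq_norm_sq_to_K, norm_pow, RCLike.norm_ofReal, abs_norm, sq]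
    have h2 := hS (S w) w; rw [h1] at h2
    exact le_of_mul_le_mul_left (h2.trans_eq (by ring)) hpos

/-- ★ **NORM BOUND FROM TWO SUP ROWS AND AN ADJOINT PAIRING**: on a finite-dimensional complex inner-product space with a coordinate reading `φ : E ≃ₗ (ι → V)`, if
`⟪Tx, y⟫ = ⟪x, T′y⟫` and `T`, `T′` have the sup rows `k`, `k′` (`∀ x s, (∀ b, ‖φ x b‖ ≤ s) → ∀ b, ‖φ(Tx) b‖ ≤ k·s`), then `‖Tx‖ ≤ (k + k′)‖x‖`: `T + T′` and `I•(T − T′)` are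
symmetric with sup rows `k + k′`, so ★p1's ✓`inner_le_of_isSymmetric_of_supRow` bounds both, and `2T = (T + T′) + (T − T′)`. [folklore] -/
theorem norm_le_of_supRow_pair [FiniteDimensional ℂ E] {ι : Type*} [Fintype ι] {V : Type*} [NormedAddCommGroup V] [NormedSpace ℂ V]
    (T T' : E →ₗ[ℂ] E) (hTT' : ∀ x y : E, ⟪T x, y⟫_ℂ = ⟪x, T' y⟫_ℂ) (φ : E ≃ₗ[ℂ] (ι → V)) {k k' : ℝ} (hk : 0 ≤ k) (hk' : 0 ≤ k')
    (hrow : ∀ (x : E) (s : ℝ), (∀ b, ‖φ x b‖ ≤ s) → ∀ b, ‖φ (T x) b‖ ≤ k * s)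
    (hrow' : ∀ (x : E) (s : ℝ), (∀ b, ‖φ x b‖ ≤ s) → ∀ b, ‖φ (T' x) b‖ ≤ k' * s) (x : E) :
    ‖T x‖ ≤ (k + k') * ‖x‖ := by
  have hT'T : ∀ x y : E, ⟪T' x, y⟫_ℂ = ⟪x, T y⟫_ℂ := fun x y => by
    rw [← inner_conj_symm, ← hTT', inner_conj_symm]
  -- the symmetric part
  have hSsym : (T + T').IsSymmetric := fun x y => by
    rw [LinearMap.add_apply, LinearMap.add_apply, inner_add_left, inner_add_right, hTT', hT'T, add_comm]
  have hSrow : ∀ (x : E) (s : ℝ), (∀ b, ‖φ x b‖ ≤ s) → ∀ b, ‖φ ((T + T') x) b‖ ≤ (k + k') * s := fun x s hs b => by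
    rw [LinearMap.add_apply, map_add, Pi.add_apply, add_mul]
    exact (norm_add_le _ _).trans (add_le_add (hrow x s hs b) (hrow' x s hs b))
  -- `I •` the antisymmetric part
  have hNsym : ((I : ℂ) • (T - T')).IsSymmetric := fun x y => by
    rw [LinearMap.smul_apply, LinearMap.smul_apply, LinearMap.sub_apply, LinearMap.sub_apply, inner_smul_left, inner_smul_right, inner_sub_left,
      inner_sub_right, hTT', hT'T, Complex.conj_I]
    ring
  have hNrow : ∀ (x : E) (s : ℝ), (∀ b, ‖φ x b‖ ≤ s) → ∀ b, ‖φ (((I : ℂ) • (T - T')) x) b‖ ≤ (k + k') * s := fun x s hs b => by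
    rw [LinearMap.smul_apply, map_smul, Pi.smul_apply, norm_smul, Complex.norm_I, one_mul, LinearMap.sub_apply, map_sub, Pi.sub_apply, add_mul]
    exact (norm_sub_le _ _).trans (add_le_add (hrow x s hs b) (hrow' x s hs b))
  have hkk : 0 ≤ k + k' := add_nonneg hk hk'
  have hS := norm_le_of_form_bound (T + T') hkk (Prop7TJL2BoundOfSupRow.inner_le_of_isSymmetric_of_supRow (T + T') hSsym φ hkk hSrow) x
  have hN := norm_le_of_form_bound ((I : ℂ) • (T - T')) hkk (Prop7TJL2BoundOfSupRow.inner_le_of_isSymmetric_of_supRow _ hNsym φ hkk hNrow) x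
  have hN' : ‖((I : ℂ) • (T - T')) x‖ = ‖T x - T' x‖ := by
    rw [LinearMap.smul_apply, norm_smul, Complex.norm_I, one_mul, LinearMap.sub_apply]
  rw [hN'] at hN; rw [LinearMap.add_apply] at hS
  have h2 : (2 : ℝ) * ‖T x‖ ≤ (k + k') * ‖x‖ + (k + k') * ‖x‖ := by
    have e : (2 : ℂ) • T x = (T x + T' x) + (T x - T' x) := by rw [two_smul]; abel
    have : ‖(2 : ℂ) • T x‖ = 2 * ‖T x‖ := by rw [norm_smul]; norm_num
    rw [← this, e]
    exact (norm_add_le _ _).trans (add_le_add hS hN)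
  linarith

end Abstract

/-! ## §2 Member: block rows ⟹ the full sup row -/

section Member

open Literature.MathematicalPhysics.QuantumFieldTheory.Balaban1983to89
open Literature.MathematicalPhysics.QuantumFieldTheory.Balaban1983to89.T3ContinuumYM3Torus
open T3SectALandauChart (eta eta_pos)
open T3PrintedRegularMinimiser (RegPr)
open B11Eq103H1Complex (BondL2K)
open B5Eq118OneStroke (iterBlockOf)
open Literature.MathematicalPhysics.QuantumFieldTheory.Balaban1983to89.Beta.CombesThomasForm (abs_exp_sub_one_le)
open Literature.Analysis.ODE (exp_sub_one_le_mul_exp)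
open Summit.QuantumFields.YangMills.Theorems.Prop7SectET3Transport (periodsT3)
open Summit.QuantumFields.YangMills.Theorems.Prop7SectET3HilbertLetters (W₂ toL2)
open Summit.QuantumFields.YangMills.Theorems.Prop7SectET3WilsonHessian (DeltaEtaSlot)
open Summit.QuantumFields.YangMills.Theorems.Prop7SectET3DeltaPiPInv (DeltaPiSlotP DeltaPiP_isSymmetric)
open Summit.QuantumFields.YangMills.Theorems.Prop7SectET3CurvedPropagators (GT PosOnto)
open Summit.QuantumFields.YangMills.Theorems.Prop7SectET3OpsT3HilbertRows (GT_isSymmetric)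
open Summit.QuantumFields.YangMills.Theorems.Prop7CoerciveOfNormG0 (DeltaEtaSlot_isSymmetric)
open Summit.QuantumFields.YangMills.Theorems.Prop7BlockDistanceWeights (sum_exp_neg_mul_tdist_coarse_le tdist_coarse_comm)
open Summit.QuantumFields.YangMills.Theorems.Prop7OneFormAgmonWeights (abs_sub_le_coarse)
open Summit.QuantumFields.YangMills.Theorems.Prop7QkWeightConjugation (inner_weight_comm)

variable (F : T3Family) {n K : ℕ} (h : n ≤ K) (c₀ cB : ℝ) [Fact (0 < c₀)] [Fact (0 < cB)]

omit [Fact (0 < c₀)] [Fact (0 < cB)] in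
/-- ★ **BLOCK ROWS ⟹ THE FULL SUP ROW**: if a linear `R` on the fine bond fields has, for every source supported on the bonds of one `(K−n)`-block `z` with sup `≤ s`, values
`≤ s·C·e^{−ν·tdist(B bd₋, z)}` (`C ≥ 0`, `ν > 0`), then for EVERY source with sup `≤ s` its values are `≤ C·(2(1+1∕ν))³·s` (block decomposition + the K-∕volume-free coarse volume
✓`sum_exp_neg_mul_tdist_coarse_le`; output in ✓`Prop7TJL2BoundOfSupRow`'s sup-row shape, reading `toL2⁻¹`). [cite: Balaban1985BackgroundPropagators, (3.49) p.399; Balaban1985Averaging, (2) p.17] -/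
theorem supRow_of_blockRows (R : BondL2K ℂ 3 (periodsT3 F K) c₀ W₂ →ₗ[ℂ] BondL2K ℂ 3 (periodsT3 F K) c₀ W₂) {C ν : ℝ} (hC : 0 ≤ C) (hν : 0 < ν)
    (hblk : ∀ (X : PBond (F.P K) 0 → Matrix (Fin 2) (Fin 2) ℂ) (z : Site (F.P K) (K - n)), (∀ b, X b ≠ 0 → iterBlockOf (K - n) b.src = z) →
      ∀ s : ℝ, 0 ≤ s → (∀ b, ‖X b‖ ≤ s) →
        ∀ bd : PBond (F.P K) 0, ‖(toL2 F K c₀).symm (R (toL2 F K c₀ X)) bd‖ ≤ s * C * Real.exp (-(ν * (Site.tdist (P := F.P K) (iterBlockOf (K - n) bd.src) z : ℝ)))) :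
    ∀ (x : BondL2K ℂ 3 (periodsT3 F K) c₀ W₂) (s : ℝ), (∀ b, ‖(toL2 F K c₀).symm x b‖ ≤ s) →
      ∀ bd : PBond (F.P K) 0, ‖(toL2 F K c₀).symm (R x) bd‖ ≤ (C * (2 * (1 + 1 / ν)) ^ 3) * s := by
  classical
  intro x s hs bd
  set X : PBond (F.P K) 0 → Matrix (Fin 2) (Fin 2) ℂ := (toL2 F K c₀).symm x with hX
  have hx : x = toL2 F K c₀ X := ((toL2 F K c₀).apply_symm_apply x).symm
  have hs0 : 0 ≤ s := (norm_nonneg _).trans (hs bd)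
  -- block decomposition of the source
  let Xz : Site (F.P K) (K - n) → PBond (F.P K) 0 → Matrix (Fin 2) (Fin 2) ℂ := fun z b => if iterBlockOf (K - n) b.src = z then X b else 0
  have hsum : ∑ z, Xz z = X := by
    funext b
    rw [Finset.sum_apply]
    simp only [Xz]
    rw [Finset.sum_ite_eq, if_pos (Finset.mem_univ _)]
  have hsupp : ∀ z b, Xz z b ≠ 0 → iterBlockOf (K - n) b.src = z := fun z b hb => by
    by_contra hne
    exact hb (by simp only [Xz, if_neg hne])
  have hbd : ∀ z b, ‖Xz z b‖ ≤ s := fun z b => by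
    by_cases hb : iterBlockOf (K - n) b.src = z
    · simp only [Xz, if_pos hb]; exact hs b
    · simp only [Xz, if_neg hb, norm_zero]; exact hs0
  have hexp : (toL2 F K c₀).symm (R x) bd = ∑ z, (toL2 F K c₀).symm (R (toL2 F K c₀ (Xz z))) bd := by
    rw [hx, ← hsum, map_sum, map_sum, map_sum, Finset.sum_apply]
  rw [hexp]
  calc ‖∑ z, (toL2 F K c₀).symm (R (toL2 F K c₀ (Xz z))) bd‖
      ≤ ∑ z, s * C * Real.exp (-(ν * (Site.tdist (P := F.P K) (iterBlockOf (K - n) bd.src) z : ℝ))) :=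
        (norm_sum_le _ _).trans (Finset.sum_le_sum fun z _ => hblk (Xz z) z (hsupp z) s hs0 (hbd z) bd)
    _ = s * C * ∑ z : Site (F.P K) (K - n), Real.exp (-(ν * (Site.tdist (P := F.P K) z (iterBlockOf (K - n) bd.src) : ℝ))) := by
        rw [Finset.mul_sum]
        exact Finset.sum_congr rfl fun z _ => by rw [tdist_coarse_comm F]
    _ ≤ s * C * (2 * (1 + 1 / ν)) ^ 3 :=
        mul_le_mul_of_nonneg_left (sum_exp_neg_mul_tdist_coarse_le F hν _) (mul_nonneg hs0 hC)
    _ = (C * (2 * (1 + 1 / ν)) ^ 3) * s := by ring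

/-! ## §3 The block rows of `M_o∘G∘M_i − G` from the block rows of `G` -/

/-- `t + 2d ≤ (1∕β + 2d)·e^{βt}` for `t, d ≥ 0`, `β > 0` (`βt + 1 ≤ e^{βt}`, `1 ≤ e^{βt}`). [folklore] -/
theorem two_d_le_exp_mul {t d β : ℝ} (ht : 0 ≤ t) (hd : 0 ≤ d) (hβ : 0 < β) : t + 2 * d ≤ (1 / β + 2 * d) * Real.exp (β * t) := by
  have h1 : β * t + 1 ≤ Real.exp (β * t) := Real.add_one_le_exp _
  have h2 : 1 ≤ Real.exp (β * t) := Real.one_le_exp (by positivity)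
  have h3 : t ≤ 1 / β * Real.exp (β * t) := by
    rw [one_div, ← div_eq_inv_mul, le_div_iff₀' hβ]
    linarith
  nlinarith

/-- **THE DECAY OF THE CONJUGATION DEFECT FACTOR**: `(e^{μ(t+2d)} − 1)·e^{−δt} ≤ μ·(2∕(δ−μ) + 2d)·e^{2dμ}·e^{−((δ−μ)∕2)t}` for `t, d ≥ 0`, `0 ≤ μ < δ`
(`e^y − 1 ≤ ye^y`, ✓`two_d_le_exp_mul` at `β := (δ−μ)∕2`). [folklore] -/
theorem exp_sub_one_decay_le {t d μ δ : ℝ} (ht : 0 ≤ t) (hd : 0 ≤ d) (hμ : 0 ≤ μ) (hμδ : μ < δ) :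
    (Real.exp (μ * (t + 2 * d)) - 1) * Real.exp (-(δ * t))
      ≤ μ * (2 / (δ - μ) + 2 * d) * Real.exp (2 * d * μ) * Real.exp (-((δ - μ) / 2 * t)) := by
  have hβ : 0 < (δ - μ) / 2 := by linarith
  have h1 : Real.exp (μ * (t + 2 * d)) - 1 ≤ μ * (t + 2 * d) * Real.exp (μ * (t + 2 * d)) := exp_sub_one_le_mul_exp _
  have h2 : t + 2 * d ≤ (1 / ((δ - μ) / 2) + 2 * d) * Real.exp ((δ - μ) / 2 * t) := two_d_le_exp_mul ht hd hβ
  have h12 : 1 / ((δ - μ) / 2) = 2 / (δ - μ) := by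
    rw [one_div, inv_div, div_eq_mul_one_div 2 (δ - μ), ← mul_div_assoc, mul_one]
  rw [h12] at h2
  have hE : 0 < Real.exp (μ * (t + 2 * d)) := Real.exp_pos _
  have hD : 0 < Real.exp (-(δ * t)) := Real.exp_pos _
  calc (Real.exp (μ * (t + 2 * d)) - 1) * Real.exp (-(δ * t))
      ≤ (μ * (t + 2 * d) * Real.exp (μ * (t + 2 * d))) * Real.exp (-(δ * t)) := mul_le_mul_of_nonneg_right h1 hD.le
    _ ≤ (μ * ((2 / (δ - μ) + 2 * d) * Real.exp ((δ - μ) / 2 * t)) * Real.exp (μ * (t + 2 * d))) * Real.exp (-(δ * t)) :=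
        mul_le_mul_of_nonneg_right (mul_le_mul_of_nonneg_right (mul_le_mul_of_nonneg_left h2 hμ) hE.le) hD.le
    _ = μ * (2 / (δ - μ) + 2 * d) * Real.exp (2 * d * μ) * Real.exp (-((δ - μ) / 2 * t)) := by
        have e : Real.exp ((δ - μ) / 2 * t) * Real.exp (μ * (t + 2 * d)) * Real.exp (-(δ * t))
            = Real.exp (2 * d * μ) * Real.exp (-((δ - μ) / 2 * t)) := by
          rw [← Real.exp_add, ← Real.exp_add, ← Real.exp_add]; congr 1; ring
        calc _ = μ * (2 / (δ - μ) + 2 * d) * (Real.exp ((δ - μ) / 2 * t) * Real.exp (μ * (t + 2 * d)) * Real.exp (-(δ * t))) := by ring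
          _ = _ := by rw [e]; ring

omit [Fact (0 < c₀)] [Fact (0 < cB)] in
/-- ★★ **THE BLOCK ROWS OF THE CONJUGATION DEFECT `M_o∘G∘M_i − G` FROM THE BLOCK ROWS OF `G`** (ANY linear `G` with `hGblk`-shaped block rows `C_G ≥ 0`, rate `δ`; a phase `ψ` of
fine slope `μη`, `0 ≤ μ < δ`; `M_o ↔ e^{ψ(b₋)}`, `M_i ↔ e^{−ψ(b₋)}`): for every source `X` supported on the bonds of one block `z` with sup `≤ s`, `‖toL2⁻¹((M_o∘G∘M_i − G)(toL2 X))(bd)‖ ≤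
s·(C_G·(μ·(2∕(δ−μ) + 2d)·e^{2dμ}))·e^{−((δ−μ)∕2)·tdist(B bd₋, z)}` — the display of the file header (`x⋆ := b₀₋`; `W := e^{ψ(x⋆)−ψ}X`; `hGblk` on `W` and on `W − X`).
[cite: Balaban1985BackgroundPropagators, Thm 3.1 (3.46) p.398, (3.49) p.399] -/
theorem blockRow_conj_sub_of_blockRows (G : BondL2K ℂ 3 (periodsT3 F K) c₀ W₂ →ₗ[ℂ] BondL2K ℂ 3 (periodsT3 F K) c₀ W₂) {CG δ μ : ℝ} (hCG : 0 ≤ CG) (hμ : 0 ≤ μ)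
    (hμδ : μ < δ)
    (hGblk : ∀ (X : PBond (F.P K) 0 → Matrix (Fin 2) (Fin 2) ℂ) (z : Site (F.P K) (K - n)), (∀ b, X b ≠ 0 → iterBlockOf (K - n) b.src = z) →
      ∀ s : ℝ, 0 ≤ s → (∀ b, ‖X b‖ ≤ s) →
        ∀ bd : PBond (F.P K) 0, ‖(toL2 F K c₀).symm (G (toL2 F K c₀ X)) bd‖ ≤ s * CG * Real.exp (-(δ * (Site.tdist (P := F.P K) (iterBlockOf (K - n) bd.src) z : ℝ))))
    (ψ : Site (F.P K) 0 → ℝ) (hψ : ∀ x x' : Site (F.P K) 0, |ψ x - ψ x'| ≤ μ * eta F n K * (Site.tdist x x' : ℝ))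
    (Mo Mi : BondL2K ℂ 3 (periodsT3 F K) c₀ W₂ →ₗ[ℂ] BondL2K ℂ 3 (periodsT3 F K) c₀ W₂)
    (hMo : ∀ X, Mo (toL2 F K c₀ X) = toL2 F K c₀ (fun b => Real.exp (ψ b.src) • X b))
    (hMi : ∀ X, Mi (toL2 F K c₀ X) = toL2 F K c₀ (fun b => Real.exp (-ψ b.src) • X b)) :
    ∀ (X : PBond (F.P K) 0 → Matrix (Fin 2) (Fin 2) ℂ) (z : Site (F.P K) (K - n)), (∀ b, X b ≠ 0 → iterBlockOf (K - n) b.src = z) →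
      ∀ s : ℝ, 0 ≤ s → (∀ b, ‖X b‖ ≤ s) →
        ∀ bd : PBond (F.P K) 0, ‖(toL2 F K c₀).symm ((Mo ∘ₗ G ∘ₗ Mi - G) (toL2 F K c₀ X)) bd‖
          ≤ s * (CG * (μ * (2 / (δ - μ) + 2 * (F.P K).d) * Real.exp (2 * (F.P K).d * μ)))
              * Real.exp (-((δ - μ) / 2 * (Site.tdist (P := F.P K) (iterBlockOf (K - n) bd.src) z : ℝ))) := by
  classical
  intro X z hXz s hs hX bd
  have hd : (0 : ℝ) ≤ (F.P K).d := Nat.cast_nonneg _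
  set t : ℝ := (Site.tdist (P := F.P K) (iterBlockOf (K - n) bd.src) z : ℝ) with ht
  have ht0 : 0 ≤ t := Nat.cast_nonneg _
  by_cases hX0 : X = 0
  · -- the zero source
    have : (toL2 F K c₀).symm ((Mo ∘ₗ G ∘ₗ Mi - G) (toL2 F K c₀ X)) bd = 0 := by rw [hX0, map_zero, map_zero, map_zero, Pi.zero_apply]
    rw [this, norm_zero]; positivity
  · -- a reference site in the source block
    obtain ⟨b₀, hb₀⟩ : ∃ b, X b ≠ 0 := by by_contra hall; exact hX0 (funext fun b => by by_contra hb; exact hall ⟨b, hb⟩)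
    set xr : Site (F.P K) 0 := b₀.src with hxr
    have hzr : iterBlockOf (K - n) xr = z := hXz b₀ hb₀
    -- the coarse-Lipschitz rows of the phase
    have hcoarse := abs_sub_le_coarse F ψ hμ hψ
    have hin : ∀ b, X b ≠ 0 → |ψ xr - ψ b.src| ≤ μ * (F.P K).d := fun b hb => by
      have h1 := hcoarse xr b.src
      rw [hzr, hXz b hb, show (Site.tdist (P := F.P K) z z : ℝ) = 0 by exact_mod_cast B3Taylor310LocalRemainder.tdist_self z, zero_add] at h1
      exact h1
    have hout : |ψ bd.src - ψ xr| ≤ μ * (t + (F.P K).d) := by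
      have h1 := hcoarse bd.src xr; rwa [hzr] at h1
    -- the re-centred source `W` and the difference `W − X`
    let W : PBond (F.P K) 0 → Matrix (Fin 2) (Fin 2) ℂ := fun b => Real.exp (ψ xr - ψ b.src) • X b
    have hWsupp : ∀ b, W b ≠ 0 → iterBlockOf (K - n) b.src = z := fun b hb => hXz b fun h0 => hb (by simp only [W, h0, smul_zero])
    have hWXsupp : ∀ b, (W - X) b ≠ 0 → iterBlockOf (K - n) b.src = z := fun b hb => hXz b fun h0 => hb (by simp only [Pi.sub_apply, W, h0, smul_zero, sub_zero])
    have hWbd : ∀ b, ‖W b‖ ≤ Real.exp (μ * (F.P K).d) * s := fun b => by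
      by_cases hb : X b = 0
      · simp only [W, hb, smul_zero, norm_zero]; positivity
      · simp only [W]
        rw [← Complex.coe_smul, norm_smul, Complex.norm_real, Real.norm_eq_abs, abs_of_pos (Real.exp_pos _)]
        exact mul_le_mul (Real.exp_le_exp.2 ((le_abs_self _).trans (hin b hb))) (hX b) (norm_nonneg _) (Real.exp_pos _).le
    have hWXbd : ∀ b, ‖(W - X) b‖ ≤ (Real.exp (μ * (F.P K).d) - 1) * s := fun b => by
      by_cases hb : X b = 0
      · simp only [Pi.sub_apply, W, hb, smul_zero, sub_zero, norm_zero]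
        exact mul_nonneg (by linarith [Real.one_le_exp (by positivity : 0 ≤ μ * (F.P K).d)]) hs
      · have e : (W - X) b = ((Real.exp (ψ xr - ψ b.src) - 1 : ℝ) : ℂ) • X b := by
          simp only [Pi.sub_apply, W]
          rw [← Complex.coe_smul, Complex.ofReal_sub, Complex.ofReal_one, sub_smul, one_smul]
        rw [e, norm_smul, Complex.norm_real, Real.norm_eq_abs]
        exact mul_le_mul (abs_exp_sub_one_le (hin b hb)) (hX b) (norm_nonneg _) (by linarith [Real.one_le_exp (by positivity : 0 ≤ μ * (F.P K).d)])
    -- the two Green values and their block rows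
    set U : PBond (F.P K) 0 → Matrix (Fin 2) (Fin 2) ℂ := (toL2 F K c₀).symm (G (toL2 F K c₀ W)) with hU
    set V : PBond (F.P K) 0 → Matrix (Fin 2) (Fin 2) ℂ := (toL2 F K c₀).symm (G (toL2 F K c₀ (W - X))) with hV
    have hUbd : ‖U bd‖ ≤ (Real.exp (μ * (F.P K).d) * s) * CG * Real.exp (-(δ * t)) := hGblk W z hWsupp _ (by positivity) hWbd bd
    have hVbd : ‖V bd‖ ≤ ((Real.exp (μ * (F.P K).d) - 1) * s) * CG * Real.exp (-(δ * t)) :=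
      hGblk (W - X) z hWXsupp _ (mul_nonneg (by linarith [Real.one_le_exp (by positivity : 0 ≤ μ * (F.P K).d)]) hs) hWXbd bd
    -- the coordinate of the defect at `bd`
    have hMiX : Mi (toL2 F K c₀ X) = ((Real.exp (-ψ xr) : ℝ) : ℂ) • toL2 F K c₀ W := by
      rw [hMi, ← map_smul]
      congr 1
      funext b
      simp only [Pi.smul_apply, W]
      rw [← Complex.coe_smul, ← Complex.coe_smul, smul_smul, ← Complex.ofReal_mul, ← Real.exp_add]
      congr 2; ring
    have hGW : G (toL2 F K c₀ W) = toL2 F K c₀ U := by rw [hU, LinearEquiv.apply_symm_apply]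
    have hcoord : (toL2 F K c₀).symm ((Mo ∘ₗ G ∘ₗ Mi - G) (toL2 F K c₀ X)) bd
        = ((Real.exp (ψ bd.src - ψ xr) - 1 : ℝ) : ℂ) • U bd + V bd := by
      have e1 : (toL2 F K c₀).symm ((Mo ∘ₗ G ∘ₗ Mi) (toL2 F K c₀ X)) bd = ((Real.exp (ψ bd.src - ψ xr) : ℝ) : ℂ) • U bd := by
        rw [LinearMap.comp_apply, LinearMap.comp_apply, hMiX, map_smul, hGW, map_smul, hMo, LinearEquiv.map_smul, LinearEquiv.symm_apply_apply,
          Pi.smul_apply, ← Complex.coe_smul, smul_smul, ← Complex.ofReal_mul, ← Real.exp_add]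
        congr 3; ring
      have e2 : (toL2 F K c₀).symm (G (toL2 F K c₀ X)) bd = U bd - V bd := by
        rw [hU, hV, map_sub, map_sub, map_sub, Pi.sub_apply, sub_sub_cancel]
      rw [LinearMap.sub_apply, map_sub, Pi.sub_apply, e1, e2, Complex.ofReal_sub, Complex.ofReal_one, sub_smul, one_smul]
      abel
    -- assemble
    rw [hcoord]
    have hfac : |Real.exp (ψ bd.src - ψ xr) - 1| ≤ Real.exp (μ * (t + (F.P K).d)) - 1 := abs_exp_sub_one_le hout
    have hE1 : 0 ≤ Real.exp (μ * (t + (F.P K).d)) - 1 := by linarith [Real.one_le_exp (by positivity : 0 ≤ μ * (t + (F.P K).d))]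
    calc ‖((Real.exp (ψ bd.src - ψ xr) - 1 : ℝ) : ℂ) • U bd + V bd‖
        ≤ |Real.exp (ψ bd.src - ψ xr) - 1| * ‖U bd‖ + ‖V bd‖ := by
          refine (norm_add_le _ _).trans (add_le_add (le_of_eq ?_) le_rfl)
          rw [norm_smul, Complex.norm_real, Real.norm_eq_abs]
      _ ≤ (Real.exp (μ * (t + (F.P K).d)) - 1) * ((Real.exp (μ * (F.P K).d) * s) * CG * Real.exp (-(δ * t)))
          + ((Real.exp (μ * (F.P K).d) - 1) * s) * CG * Real.exp (-(δ * t)) :=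
          add_le_add (mul_le_mul hfac hUbd (norm_nonneg _) hE1) hVbd
      _ = s * CG * ((Real.exp (μ * (t + 2 * (F.P K).d)) - 1) * Real.exp (-(δ * t))) := by
          have e : Real.exp (μ * (t + (F.P K).d)) * Real.exp (μ * (F.P K).d) = Real.exp (μ * (t + 2 * (F.P K).d)) := by
            rw [← Real.exp_add]; congr 1; ring
          rw [← e]; ring
      _ ≤ s * CG * (μ * (2 / (δ - μ) + 2 * (F.P K).d) * Real.exp (2 * (F.P K).d * μ) * Real.exp (-((δ - μ) / 2 * t))) :=
          mul_le_mul_of_nonneg_left (exp_sub_one_decay_le ht0 hd hμ hμδ) (mul_nonneg hs hCG)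
      _ = _ := by ring

/-! ## §4 ★★★ The `hres` letter at any slot from the slot's `hGblk` letter -/

/-- ★★★ **THE CONJUGATED-RESOLVENT ROW OF `G` AT ANY SLOT FROM THE SLOT'S GREEN BLOCK ROWS.**  Member `F n K`, weights `c₀ cB`, ANY slot `Δx`, coupling `a`, `PosOnto … a Δx U₀`
and `(Δx U₀).IsSymmetric` (so `G` is symmetric, ✓`GT_isSymmetric`); the `hGblk` letter of px10's H-DOOR VERBATIM (`C_G ≥ 0`, rate `δ`); `0 ≤ μ < δ`.  THEN **px10's `hres` TEXT**
(✓`kinvRow_of_coercive_of_conjResolvent`'s binder, token for token) with `δ₃ := 2·(C_G·(μ·(2∕(δ−μ) + 6)·e^{6μ})·(2(1+2∕(δ−μ)))³)` (`2d = 6`) — `O(μ)·C_G`, K-free iff `C_G` is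
(§3 for `T` and for `T′ = M_fi∘G∘M_f − G` at `ψ := ±φ`, §2, §1). [cite: Balaban1985BackgroundPropagators, Thm 3.1 (3.46) p.398, (3.49) p.399, (3.132) p.422; Balaban1984PropagatorsII, §2] -/
theorem conj_resolvent_of_greenBlockSup (U₀ : GaugeField (F.P K) 0 (Matrix.specialUnitaryGroup (Fin 2) ℂ)) (a : ℝ)
    (Δx : GaugeField (F.P K) 0 (Matrix.specialUnitaryGroup (Fin 2) ℂ) → (BondL2K ℂ 3 (periodsT3 F K) c₀ W₂ →ₗ[ℂ] BondL2K ℂ 3 (periodsT3 F K) c₀ W₂))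
    (hp : PosOnto F n K h c₀ cB a Δx U₀) (hΔs : (Δx U₀).IsSymmetric) {CG δ μ : ℝ} (hCG : 0 ≤ CG) (hμ : 0 ≤ μ) (hμδ : μ < δ)
    (hGblk : ∀ (X : PBond (F.P K) 0 → Matrix (Fin 2) (Fin 2) ℂ) (z : Site (F.P K) (K - n)), (∀ b, X b ≠ 0 → iterBlockOf (K - n) b.src = z) →
      ∀ s : ℝ, 0 ≤ s → (∀ b, ‖X b‖ ≤ s) →
        ∀ bd : PBond (F.P K) 0, ‖(toL2 F K c₀).symm (GT F n K h c₀ cB a Δx U₀ (toL2 F K c₀ X)) bd‖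
          ≤ s * CG * Real.exp (-(δ * (Site.tdist (P := F.P K) (iterBlockOf (K - n) bd.src) z : ℝ)))) :
    ∀ φ : Site (F.P K) 0 → ℝ, (∀ x x' : Site (F.P K) 0, |φ x - φ x'| ≤ μ * eta F n K * (Site.tdist x x' : ℝ)) →
      ∀ (Mf Mfi : BondL2K ℂ 3 (periodsT3 F K) c₀ W₂ →ₗ[ℂ] BondL2K ℂ 3 (periodsT3 F K) c₀ W₂),
        (∀ X, Mf (toL2 F K c₀ X) = toL2 F K c₀ (fun b => Real.exp (φ b.src) • X b)) →
        (∀ X, Mfi (toL2 F K c₀ X) = toL2 F K c₀ (fun b => (Real.exp (φ b.src))⁻¹ • X b)) →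
        ∀ x, ‖Mf (GT F n K h c₀ cB a Δx U₀ (Mfi x)) - GT F n K h c₀ cB a Δx U₀ x‖
          ≤ (2 * ((CG * (μ * (2 / (δ - μ) + 6) * Real.exp (6 * μ))) * (2 * (1 + 2 / (δ - μ))) ^ 3)) * ‖x‖ := by
  intro φ hφ Mf Mfi hMf hMfi x
  have hν : 0 < (δ - μ) / 2 := by linarith
  set G := GT F n K h c₀ cB a Δx U₀ with hG
  -- the multiplier rows in exponential form
  have hMfi' : ∀ X, Mfi (toL2 F K c₀ X) = toL2 F K c₀ (fun b => Real.exp (-φ b.src) • X b) := fun X => by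
    rw [hMfi]; congr 1; funext b; rw [Real.exp_neg]
  have hMf' : ∀ X, Mf (toL2 F K c₀ X) = toL2 F K c₀ (fun b => Real.exp (-(-φ b.src)) • X b) := fun X => by
    rw [hMf]; congr 1; funext b; rw [neg_neg]
  have hφ' : ∀ x x' : Site (F.P K) 0, |(-φ x) - (-φ x')| ≤ μ * eta F n K * (Site.tdist x x' : ℝ) := fun x x' => by
    rw [show (-φ x) - (-φ x') = φ x' - φ x by ring, B3Taylor310LocalRemainder.tdist_comm]; exact hφ x' x
  have hGs : G.IsSymmetric := GT_isSymmetric hp hΔs -- the adjoint pairing `⟪Tx, y⟫ = ⟪x, T′y⟫`: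
  have hTT' : ∀ x y : BondL2K ℂ 3 (periodsT3 F K) c₀ W₂,
      ⟪(Mf ∘ₗ G ∘ₗ Mfi - G) x, y⟫_ℂ = ⟪x, (Mfi ∘ₗ G ∘ₗ Mf - G) y⟫_ℂ := fun x y => by
    rw [LinearMap.sub_apply, LinearMap.sub_apply, LinearMap.comp_apply, LinearMap.comp_apply, LinearMap.comp_apply, LinearMap.comp_apply,
      inner_sub_left, inner_sub_right, inner_weight_comm (fun b : PBond (F.P K) 0 => Real.exp (φ b.src)) Mf hMf, hGs,
      inner_weight_comm (fun b : PBond (F.P K) 0 => (Real.exp (φ b.src))⁻¹) Mfi hMfi, hGs x y]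
  -- the two sup rows
  have hk : 0 ≤ (CG * (μ * (2 / (δ - μ) + 2 * (F.P K).d) * Real.exp (2 * (F.P K).d * μ))) * (2 * (1 + 1 / ((δ - μ) / 2))) ^ 3 := by positivity
  have hrow := supRow_of_blockRows F c₀ (Mf ∘ₗ G ∘ₗ Mfi - G) (by positivity) hν
    (blockRow_conj_sub_of_blockRows F c₀ G hCG hμ hμδ hGblk φ hφ Mf Mfi hMf hMfi')
  have hrow' := supRow_of_blockRows F c₀ (Mfi ∘ₗ G ∘ₗ Mf - G) (by positivity) hν
    (blockRow_conj_sub_of_blockRows F c₀ G hCG hμ hμδ hGblk (fun x => -φ x) hφ' Mfi Mf hMfi' hMf')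
  have hfin := norm_le_of_supRow_pair _ _ hTT' (toL2 F K c₀).symm hk hk hrow hrow' x
  rw [LinearMap.sub_apply, LinearMap.comp_apply, LinearMap.comp_apply] at hfin
  have hd : ((F.P K).d : ℝ) = 3 := by exact_mod_cast T3Family.P_d F K
  have hcon : (CG * (μ * (2 / (δ - μ) + 2 * ((F.P K).d : ℝ)) * Real.exp (2 * ((F.P K).d : ℝ) * μ))) * (2 * (1 + 1 / ((δ - μ) / 2))) ^ 3
      = (CG * (μ * (2 / (δ - μ) + 6) * Real.exp (6 * μ))) * (2 * (1 + 2 / (δ - μ))) ^ 3 := by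
    rw [hd, one_div_div]; norm_num
  rw [two_mul]; rwa [hcon] at hfin

/-! ## §5 The two slots of record -/

/-- ★★ **`hres` AT THE SLOT OF RECORD `Δx := DeltaEtaSlot`** from N4's `hGblk`(η) (slot symmetry ✓`DeltaEtaSlot_isSymmetric`). [cite: Balaban1985BackgroundPropagators, Thm 3.1 (3.46) p.398, (3.10)–(3.12) p.392] -/
theorem conj_resolvent_DeltaEtaSlot_of_greenBlockSup (U₀ : GaugeField (F.P K) 0 (Matrix.specialUnitaryGroup (Fin 2) ℂ)) (a : ℝ)
    (hp : PosOnto F n K h c₀ cB a (DeltaEtaSlot F n K c₀) U₀) {CG δ μ : ℝ} (hCG : 0 ≤ CG) (hμ : 0 ≤ μ) (hμδ : μ < δ)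
    (hGblk : ∀ (X : PBond (F.P K) 0 → Matrix (Fin 2) (Fin 2) ℂ) (z : Site (F.P K) (K - n)), (∀ b, X b ≠ 0 → iterBlockOf (K - n) b.src = z) →
      ∀ s : ℝ, 0 ≤ s → (∀ b, ‖X b‖ ≤ s) →
        ∀ bd : PBond (F.P K) 0, ‖(toL2 F K c₀).symm (GT F n K h c₀ cB a (DeltaEtaSlot F n K c₀) U₀ (toL2 F K c₀ X)) bd‖
          ≤ s * CG * Real.exp (-(δ * (Site.tdist (P := F.P K) (iterBlockOf (K - n) bd.src) z : ℝ)))) :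
    ∀ φ : Site (F.P K) 0 → ℝ, (∀ x x' : Site (F.P K) 0, |φ x - φ x'| ≤ μ * eta F n K * (Site.tdist x x' : ℝ)) →
      ∀ (Mf Mfi : BondL2K ℂ 3 (periodsT3 F K) c₀ W₂ →ₗ[ℂ] BondL2K ℂ 3 (periodsT3 F K) c₀ W₂),
        (∀ X, Mf (toL2 F K c₀ X) = toL2 F K c₀ (fun b => Real.exp (φ b.src) • X b)) →
        (∀ X, Mfi (toL2 F K c₀ X) = toL2 F K c₀ (fun b => (Real.exp (φ b.src))⁻¹ • X b)) →
        ∀ x, ‖Mf (GT F n K h c₀ cB a (DeltaEtaSlot F n K c₀) U₀ (Mfi x)) - GT F n K h c₀ cB a (DeltaEtaSlot F n K c₀) U₀ x‖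
          ≤ (2 * ((CG * (μ * (2 / (δ - μ) + 6) * Real.exp (6 * μ))) * (2 * (1 + 2 / (δ - μ))) ^ 3)) * ‖x‖ :=
  conj_resolvent_of_greenBlockSup F h c₀ cB U₀ a _ hp (DeltaEtaSlot_isSymmetric (F := F) (n := n) (K := K) (c₀ := c₀) U₀) hCG hμ hμδ hGblk

/-- ★★ **`hres` AT THE Π-SLOT `Δx := DeltaPiSlotP … a`** from N6 D3's `hGblk`(Π) (slot symmetry ✓`DeltaPiP_isSymmetric`). [cite: Balaban1985BackgroundPropagators, Thm 3.12 p.423, (3.118)–(3.122) pp.419–420] -/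
theorem conj_resolvent_DeltaPiSlotP_of_greenBlockSup (U₀ : GaugeField (F.P K) 0 (Matrix.specialUnitaryGroup (Fin 2) ℂ)) (a : ℝ)
    (hp : PosOnto F n K h c₀ cB a (DeltaPiSlotP F n K h c₀ cB a) U₀) {CG δ μ : ℝ} (hCG : 0 ≤ CG) (hμ : 0 ≤ μ) (hμδ : μ < δ)
    (hGblk : ∀ (X : PBond (F.P K) 0 → Matrix (Fin 2) (Fin 2) ℂ) (z : Site (F.P K) (K - n)), (∀ b, X b ≠ 0 → iterBlockOf (K - n) b.src = z) →
      ∀ s : ℝ, 0 ≤ s → (∀ b, ‖X b‖ ≤ s) →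
        ∀ bd : PBond (F.P K) 0, ‖(toL2 F K c₀).symm (GT F n K h c₀ cB a (DeltaPiSlotP F n K h c₀ cB a) U₀ (toL2 F K c₀ X)) bd‖
          ≤ s * CG * Real.exp (-(δ * (Site.tdist (P := F.P K) (iterBlockOf (K - n) bd.src) z : ℝ)))) :
    ∀ φ : Site (F.P K) 0 → ℝ, (∀ x x' : Site (F.P K) 0, |φ x - φ x'| ≤ μ * eta F n K * (Site.tdist x x' : ℝ)) →
      ∀ (Mf Mfi : BondL2K ℂ 3 (periodsT3 F K) c₀ W₂ →ₗ[ℂ] BondL2K ℂ 3 (periodsT3 F K) c₀ W₂),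
        (∀ X, Mf (toL2 F K c₀ X) = toL2 F K c₀ (fun b => Real.exp (φ b.src) • X b)) →
        (∀ X, Mfi (toL2 F K c₀ X) = toL2 F K c₀ (fun b => (Real.exp (φ b.src))⁻¹ • X b)) →
        ∀ x, ‖Mf (GT F n K h c₀ cB a (DeltaPiSlotP F n K h c₀ cB a) U₀ (Mfi x)) - GT F n K h c₀ cB a (DeltaPiSlotP F n K h c₀ cB a) U₀ x‖
          ≤ (2 * ((CG * (μ * (2 / (δ - μ) + 6) * Real.exp (6 * μ))) * (2 * (1 + 2 / (δ - μ))) ^ 3)) * ‖x‖ :=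
  conj_resolvent_of_greenBlockSup F h c₀ cB U₀ a _ hp (DeltaPiP_isSymmetric (F := F) (n := n) (K := K) (h := h) (c₀ := c₀) (cB := cB) (a := a) U₀) hCG hμ hμδ hGblk

end Member

end Summit.QuantumFields.YangMills.Theorems.Prop7ConjResolventOfGreenBlockRows

end
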